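import Literature.AlgebraicTopology.SingularHomology.LocalHomology
import Literature.AlgebraicTopology.SingularHomology.ExcisionMayerVietoris
import HarnessLib

/-!
# Mayer–Vietoris criteria in every degree (concrete singular homology)

Consequences of the **proved** concrete Mayer–Vietoris short exact sequence `Literature.AlgebraicTopology.SingularHomology.mvSES` of
`Literature.AlgebraicTopology.SingularHomology.LocalHomology` (A. Hatcher, *Algebraic Topology*,
CUP 2002, §2.2, pp. 149–150) for the concrete singular homology `Literature.csingularHomology R M X` of
`…SingularChainsConcrete`, in the form needed by Mayer–Vietoris computations with pieces whose
homology is known only partially. For open `A`, `B ⊆ X` and any degree `j`: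

* `isZero_csingularHomology_union_of_mono`: `Hⱼ₊₁(A) = Hⱼ₊₁(B) = 0` and `Hⱼ(A ∩ B) → Hⱼ(A)`
  injective `⟹ Hⱼ₊₁(A ∪ B) = 0`;
* `mono_csingularHomology_map_subsetInclusion_inter`: `Hⱼ₊₁(A ∪ B) = 0`, `Hⱼ(B) = 0 ⟹`
  `Hⱼ(A ∩ B) → Hⱼ(A)` injective;
* `isZero_csingularHomology_of_union_of_inter`: `Hⱼ(A ∪ B) = 0`, `Hⱼ(A ∩ B) = 0 ⟹ Hⱼ(A) = 0`.

The identification of (the first component of) the first Mayer–Vietoris map with the map induced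
by the inclusion `A ∩ B ↪ A` (spelled `subsetInclusion (inter_subset_left : A ∩ B ⊆ A)` as in
`…ExcisionMayerVietoris`, whose Mathlib-model Mayer–Vietoris map `φ` has the same first component)
is `csingularHomology_map_subsetInclusion_inter` / `mono_map_subsetInclusion_inter_iff` (degree `0`
and nested-subspace forms of this comparison are
`Literature.AlgebraicTopology.SingularHomology.mono_homologyMap_incl_zero` of `…ExcisionMayerVietorisProofs` and
`Literature.AlgebraicTopology.SingularHomology.clocalHomology.isIso_homologyMap_incl_of_isIso` of `…LocalHomology`), and
`csingularHomology.mono_map_of_conj` transports injectivity on `Hₙ` along homeomorphisms.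

Related proved special cases elsewhere in the trunk: `Literature.AlgebraicTopology.SingularHomology.isZero_of_mv` (`…LocalHomology`,
`Hⱼ(A ∩ B) = 0`), `Literature.AlgebraicTopology.SingularHomology.isZero_one_of_mv` (`…ExcisionMayerVietorisProofs`, degree one with
`A ∩ B` path connected); the Mathlib-model analogues from the *named* Mayer–Vietoris facts are
`Literature.Topology.FourManifolds.mayerVietoris.isZero_of_mono_inter`/`mono_inter_of_isZero`
(`Literature/Topology/FourManifolds/GluckTwistHomology.lean`) and
`Literature.AlgebraicTopology.SingularHomology.SphereComplement.isZero_inter_of_isZero_union` (`…SphereComplement`). First client: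
`Literature.Topology.FourManifolds.GluckTwistHomologyProofs` (`H₂` of a Gluck twist).

Everything is proved ([folklore] glue over Hatcher §2.2); nothing is asserted.

## References

* A. Hatcher, *Algebraic Topology*, CUP 2002, §2.2 pp. 149–150 [HatcherAT2002].

## Design notes

* As in `…SingularChainsConcrete`/`…LocalHomology`, `backward.isDefEq.respectTransparency` is
  turned off for this file (chains of the concrete complex are `Finsupp`s up to unfolding).
* Sign conventions: `Literature.AlgebraicTopology.SingularHomology.mvSES` uses `x ↦ (x, x)`, `(y, z) ↦ y - z` (not Hatcher's
  `x ↦ (x, -x)`, `(y, z) ↦ y + z`); only exactness and the first component of the first map are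
  used, so the criteria are insensitive to the choice.
* No declaration in this file uses `sorry`.
-/

noncomputable section

-- as in `SingularChainsConcrete` / `LocalHomology`: chains of the concrete complex are `Finsupp`s
-- up to unfolding
set_option backward.isDefEq.respectTransparency false

open CategoryTheory Limits Set

universe u v

namespace Literature.AlgebraicTopology.SingularHomology

variable (R : Type v) [CommRing R] (M : Type v) [AddCommGroup M] [Module R M]

/-! ### Mayer–Vietoris criteria in the concrete model -/

section MayerVietorisCriteria

variable {X : Type u} [TopologicalSpace X] (A B : Set X)

/-- The chain-level factorisation of `C(A ∩ B ↪ A)` through the Mayer–Vietoris subcomplexes: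
`C(↥(A ∩ B)) ≅ C(A ∩ B) = C(A) ⊓ C(B) ↪ C(A) ≅ C(↥A)` (Hatcher 2002, §2.2, p. 150). [folklore] -/
lemma csingularChainComplex_map_subsetInclusion_inter :
    csingularChainComplex.map R M (subsetInclusion (inter_subset_left : A ∩ B ⊆ A)) =
      subspaceLift R M X (A ∩ B) ≫ Subcomplex.incl (chainsInSub_inter R M A B).le ≫
        Subcomplex.incl (inf_le_left : chainsInSub R M X A ⊓ chainsInSub R M X B ≤ _) ≫
          inv (subspaceLift R M X A) := by
  rw [Subcomplex.incl_comp_incl_assoc, clocalHomology.subspaceLift_comp_incl_assoc,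
    IsIso.hom_inv_id, Category.comp_id]

/-- `H(A ∩ B ↪ A)` factors as (iso) ≫ `H(incl : C(A) ⊓ C(B) → C(A))` ≫ (iso). [folklore] -/
lemma csingularHomology_map_subsetInclusion_inter (j : ℕ) :
    csingularHomology.map R M (subsetInclusion (inter_subset_left : A ∩ B ⊆ A)) j =
      (HomologicalComplex.homologyMap (subspaceLift R M X (A ∩ B)) j ≫
        HomologicalComplex.homologyMap (Subcomplex.incl (chainsInSub_inter R M A B).le) j) ≫
        HomologicalComplex.homologyMap
          (Subcomplex.incl (inf_le_left : chainsInSub R M X A ⊓ chainsInSub R M X B ≤ _)) j ≫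
          HomologicalComplex.homologyMap (inv (subspaceLift R M X A)) j := by
  rw [csingularHomology.map, csingularChainComplex_map_subsetInclusion_inter,
    HomologicalComplex.homologyMap_comp, HomologicalComplex.homologyMap_comp,
    HomologicalComplex.homologyMap_comp, Category.assoc]

/-- `H(incl : C(A ∩ B) → C(A) ⊓ C(B))` is an isomorphism (equal subcomplexes). [folklore] -/
instance isIso_homologyMap_incl_inter (j : ℕ) :
    IsIso (HomologicalComplex.homologyMap (Subcomplex.incl (chainsInSub_inter R M A B).le) j) :=
  haveI := Subcomplex.isIso_incl_of_eq (chainsInSub_inter R M A B)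
  inferInstance

/-- `H(A ∩ B ↪ A)` is a monomorphism iff `H(incl : C(A) ⊓ C(B) → C(A))` is. [folklore] -/
lemma mono_map_subsetInclusion_inter_iff (j : ℕ) :
    Mono (csingularHomology.map R M (subsetInclusion (inter_subset_left : A ∩ B ⊆ A)) j) ↔
      Mono (HomologicalComplex.homologyMap
        (Subcomplex.incl (inf_le_left : chainsInSub R M X A ⊓ chainsInSub R M X B ≤ _)) j) := by
  rw [csingularHomology_map_subsetInclusion_inter]
  constructor
  · intro h
    have e : HomologicalComplex.homologyMap
          (Subcomplex.incl (inf_le_left : chainsInSub R M X A ⊓ chainsInSub R M X B ≤ _)) j ≫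
          HomologicalComplex.homologyMap (inv (subspaceLift R M X A)) j =
        inv (HomologicalComplex.homologyMap (subspaceLift R M X (A ∩ B)) j ≫
          HomologicalComplex.homologyMap (Subcomplex.incl (chainsInSub_inter R M A B).le) j) ≫
          ((HomologicalComplex.homologyMap (subspaceLift R M X (A ∩ B)) j ≫
            HomologicalComplex.homologyMap (Subcomplex.incl (chainsInSub_inter R M A B).le) j) ≫
          HomologicalComplex.homologyMap
            (Subcomplex.incl (inf_le_left : chainsInSub R M X A ⊓ chainsInSub R M X B ≤ _)) j ≫
            HomologicalComplex.homologyMap (inv (subspaceLift R M X A)) j) := by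
      rw [IsIso.inv_hom_id_assoc]
    haveI : Mono (HomologicalComplex.homologyMap
          (Subcomplex.incl (inf_le_left : chainsInSub R M X A ⊓ chainsInSub R M X B ≤ _)) j ≫
          HomologicalComplex.homologyMap (inv (subspaceLift R M X A)) j) := by
      rw [e]; infer_instance
    exact mono_of_mono _ (HomologicalComplex.homologyMap (inv (subspaceLift R M X A)) j)
  · intro h
    infer_instance

variable {A B} in
/-- **Mayer–Vietoris, vanishing criterion** (concrete form, proved). Let `A`, `B ⊆ X` be open. If
`Hⱼ₊₁(A; M) = 0`, `Hⱼ₊₁(B; M) = 0` and `A ∩ B ↪ A` is injective on `Hⱼ(−; M)` then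
`Hⱼ₊₁(A ∪ B; M) = 0`: in `Hⱼ₊₁(A) ⊕ Hⱼ₊₁(B) → Hⱼ₊₁(A ∪ B) →δ Hⱼ(A ∩ B) → Hⱼ(A) ⊕ Hⱼ(B)` the
connecting map `δ` is injective (its kernel is the image of `0`) and `δ` followed by the injective
last map is `0`, so `δ = 0` (Hatcher, *Algebraic Topology*, §2.2, p. 149).
[cite: HatcherAT2002, §2.2 p. 149] -/
theorem isZero_csingularHomology_union_of_mono (hA : IsOpen A) (hB : IsOpen B) (j : ℕ)
    (hA1 : IsZero (csingularHomology R M A (j + 1)))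
    (hB1 : IsZero (csingularHomology R M B (j + 1)))
    (hm : Mono (csingularHomology.map R M (subsetInclusion (inter_subset_left : A ∩ B ⊆ A)) j)) :
    IsZero (csingularHomology R M ↥(A ∪ B) (j + 1)) := by
  have hX₂ : IsZero ((mvSES R M X A B).X₂.homology (j + 1)) :=
    isZero_mvX₂_homology R M A B _ hA1 hB1
  haveI := (mvSES_shortExact R M A B).mono_δ (j + 1) j rfl hX₂
  haveI : Mono (HomologicalComplex.homologyMap (mvSES R M X A B).f j) := by
    haveI := (mono_map_subsetInclusion_inter_iff R M A B j).1 hm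
    have w : HomologicalComplex.homologyMap (mvSES R M X A B).f j ≫
        HomologicalComplex.homologyMap (biprod.fst : (chainsInSub R M X A).toComplex ⊞
          (chainsInSub R M X B).toComplex ⟶ _) j =
        HomologicalComplex.homologyMap
          (Subcomplex.incl (inf_le_left : chainsInSub R M X A ⊓ chainsInSub R M X B ≤ _)) j := by
      rw [← HomologicalComplex.homologyMap_comp, Subcomplex.mvSub_f, biprod.lift_fst]
    exact mono_of_mono_fac w
  have hδ0 : (mvSES_shortExact R M A B).δ (j + 1) j rfl = 0 :=
    zero_of_comp_mono (HomologicalComplex.homologyMap (mvSES R M X A B).f j)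
      ((mvSES_shortExact R M A B).δ_comp (j + 1) j rfl)
  exact (IsZero.of_mono_eq_zero _ hδ0).of_iso (mvUnionHomologyIso R M hA hB (j + 1)).symm

variable {A B} in
/-- **Mayer–Vietoris, injectivity criterion** (concrete form, proved). Let `A`, `B ⊆ X` be open.
If `Hⱼ₊₁(A ∪ B; M) = 0` and `Hⱼ(B; M) = 0` then `A ∩ B ↪ A` is injective on `Hⱼ(−; M)`: the
connecting map `Hⱼ₊₁(A ∪ B) → Hⱼ(A ∩ B)` vanishes, so `x ↦ (i_{A*} x, i_{B*} x) = (i_{A*} x, 0)`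
is injective by exactness at `Hⱼ(A ∩ B)` (Hatcher, *Algebraic Topology*, §2.2, p. 149).
[cite: HatcherAT2002, §2.2 p. 149] -/
theorem mono_csingularHomology_map_subsetInclusion_inter (hA : IsOpen A) (hB : IsOpen B) (j : ℕ)
    (hU : IsZero (csingularHomology R M ↥(A ∪ B) (j + 1)))
    (hB0 : IsZero (csingularHomology R M B j)) :
    Mono (csingularHomology.map R M (subsetInclusion (inter_subset_left : A ∩ B ⊆ A)) j) := by
  have h3 : IsZero ((mvSES R M X A B).X₃.homology (j + 1)) :=
    hU.of_iso (mvUnionHomologyIso R M hA hB (j + 1))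
  have hδ0 : (mvSES_shortExact R M A B).δ (j + 1) j rfl = 0 := h3.eq_of_src _ _
  have hf : Mono (HomologicalComplex.homologyMap (mvSES R M X A B).f j) :=
    ((mvSES_shortExact R M A B).homology_exact₁ (j + 1) j rfl).mono_g hδ0
  have hT : IsZero ((chainsInSub R M X B).toComplex.homology j) :=
    hB0.of_iso (homologySubIso R M X B j)
  haveI := ModuleCat.subsingleton_of_isZero hT
  rw [mono_map_subsetInclusion_inter_iff, ModuleCat.mono_iff_injective, injective_iff_map_eq_zero]
  intro x hx
  rw [ModuleCat.mono_iff_injective] at hf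
  apply hf
  rw [map_zero]
  change HomologicalComplex.homologyMap (Subcomplex.mvSubF _ _) j x = 0
  rw [homologyMap_lift_eq_zero_iff]
  exact ⟨hx, Subsingleton.elim _ _⟩

variable {A B} in
/-- **Mayer–Vietoris, exactness at `Hⱼ(A) ⊕ Hⱼ(B)`** (concrete form, proved). Let `A`, `B ⊆ X`
be open. If `Hⱼ(A ∪ B; M) = 0` and `Hⱼ(A ∩ B; M) = 0` then `Hⱼ(A; M) = 0`: by exactness of
`Hⱼ(A ∩ B) → Hⱼ(A) ⊕ Hⱼ(B) → Hⱼ(A ∪ B)` the middle term vanishes, and `Hⱼ(A)` is a retract of it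
(Hatcher, *Algebraic Topology*, §2.2, p. 149). [cite: HatcherAT2002, §2.2 p. 149] -/
theorem isZero_csingularHomology_of_union_of_inter (hA : IsOpen A) (hB : IsOpen B) (j : ℕ)
    (hU : IsZero (csingularHomology R M ↥(A ∪ B) j))
    (hI : IsZero (csingularHomology R M ↥(A ∩ B) j)) :
    IsZero (csingularHomology R M A j) := by
  have h3 : IsZero ((mvSES R M X A B).X₃.homology j) := hU.of_iso (mvUnionHomologyIso R M hA hB j)
  have h1 : IsZero ((mvSES R M X A B).X₁.homology j) := hI.of_iso (mvInterHomologyIso R M A B j)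
  have hg0 : HomologicalComplex.homologyMap (mvSES R M X A B).g j = 0 := h3.eq_of_tgt _ _
  haveI : Epi (HomologicalComplex.homologyMap (mvSES R M X A B).f j) :=
    ((mvSES_shortExact R M A B).homology_exact₂ j).epi_f hg0
  have hX₂ : IsZero ((mvSES R M X A B).X₂.homology j) :=
    IsZero.of_epi (HomologicalComplex.homologyMap (mvSES R M X A B).f j) h1
  have hS : IsZero ((chainsInSub R M X A).toComplex.homology j) := by
    rw [IsZero.iff_id_eq_zero, ← HomologicalComplex.homologyMap_id, ← biprod.inl_fst,
      HomologicalComplex.homologyMap_comp]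
    rw [hX₂.eq_of_tgt (HomologicalComplex.homologyMap
      (biprod.inl : _ ⟶ (chainsInSub R M X A).toComplex ⊞ (chainsInSub R M X B).toComplex) j) 0,
      zero_comp]
  exact hS.of_iso (homologySubIso R M X A j).symm

end MayerVietorisCriteria

/-! ### Transport of injectivity along homeomorphisms (concrete homology) -/

section Transport

variable {A B A' B' : Type u} [TopologicalSpace A] [TopologicalSpace B] [TopologicalSpace A']
  [TopologicalSpace B']

/-- Injectivity on `Hₙ` is invariant under conjugation by homeomorphisms: if `f ∘ eA = eB ∘ g`
with `eA`, `eB` homeomorphisms and `Hₙ(g)` is a monomorphism then so is `Hₙ(f)` (concrete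
singular homology; functoriality only). [folklore] -/
theorem csingularHomology.mono_map_of_conj (f : C(A, B)) (g : C(A', B')) (eA : A' ≃ₜ A)
    (eB : B' ≃ₜ B) (hfg : ∀ x, f (eA x) = eB (g x)) (n : ℕ)
    (hg : Mono (csingularHomology.map R M g n)) : Mono (csingularHomology.map R M f n) := by
  have h1 : f.comp (eA : C(A', A)) = (eB : C(B', B)).comp g := by
    ext x
    exact hfg x
  have h2 : csingularHomology.map R M (eA : C(A', A)) n ≫ csingularHomology.map R M f n =
      csingularHomology.map R M g n ≫ csingularHomology.map R M (eB : C(B', B)) n := by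
    rw [← csingularHomology.map_comp, ← csingularHomology.map_comp, h1]
  haveI : Mono (csingularHomology.map R M (eB : C(B', B)) n) := by
    rw [← csingularHomology.mapIso_hom]; infer_instance
  haveI : Mono (csingularHomology.map R M (eA : C(A', A)) n ≫ csingularHomology.map R M f n) := by
    rw [h2]; infer_instance
  have h3 : csingularHomology.map R M f n = (csingularHomology.mapIso R M eA n).inv ≫
      (csingularHomology.map R M (eA : C(A', A)) n ≫ csingularHomology.map R M f n) := by
    rw [← Category.assoc, ← csingularHomology.mapIso_hom, Iso.inv_hom_id, Category.id_comp]
  rw [h3]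
  exact mono_comp _ _

end Transport

end Literature.AlgebraicTopology.SingularHomology

end
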